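import Literature.Probability.LatticeModels.GinibreInequality
import HarnessLib

/-!
# The Messager–Miracle-Solé–Pfister inequality in Ginibre's general framework: phases on the
# couplings and on the observable only lower the correlations of a ferromagnetic abelian model

A. Messager, S. Miracle-Solé, C. Pfister, *Correlation inequalities and uniqueness of the
equilibrium state for the plane rotator ferromagnetic model*, Comm. Math. Phys. **58** (1978)
19–29, Proposition 1 (restated verbatim for the two-point function of the `XY` model with edge
disorder as Prop. 7.16, p. 37 of P. Dario, C. Garban *et al.*, arXiv:2311.16546, with the remark
«in the article [MMP], the correlation inequality is proved in a much more general framework»;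
proof by Ginibre duplication printed in C. Garban, T. Spencer, J. Math. Phys. **63** (2022),
Appendix Thm. 7.1). The tree already PROVES the bond-system (`XY`, uniform coupling `β`) case:
`Literature.Probability.LatticeModels.BondSystem.expect_reChar_le_expect_one` (`MMPInequality.lean`).

This file PROVES the general framework version, in the vocabulary of the tree's Ginibre toolkit
(`GinibreModel`, `GinibrePositiveKernels`, `GinibreInequality`): `Ω` any compact second-countable
abelian group in which every element is a square (e.g. a torus `U(1)^E`), `μ` a Haar probability
measure, ARBITRARY continuous unitary interaction characters `χₐ : Ω → U(1)` (many-body terms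
allowed — in `U(1)` lattice gauge theory the plaquette holonomies), ARBITRARY ferromagnetic
couplings `Jₐ ≥ 0` (not necessarily uniform), arbitrary phases `uₐ ∈ U(1)` on the couplings AND an
arbitrary phase `ξ ∈ U(1)` on the observed character `χ₀`:

* `phasedGinibreExpect_rePhased_le` (**MMP, general form**):
  `⟨Re(ξ χ₀)⟩_{J,u} ≤ ⟨Re χ₀⟩_{J,1}` where `⟨·⟩_{J,u}` is the Gibbs state of the weight
  `exp(∑ₐ Jₐ Re(uₐ χₐ))` (`phasedGinibreWeight`; for `u ≡ 1` this is the tree's `ginibreWeight`,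
  `phasedGinibreExpect_one`);
* `abs_phasedGinibreExpect_rePhased_le`: `|⟨Re(ξ χ₀)⟩_{J,u}| ≤ ⟨Re χ₀⟩_{J,1}` (apply the above to
  `ξ` and `−ξ`);
* `abs_phasedGinibreExpect_re_mul_le` (**complex form**): for every `w ∈ ℂ`,
  `|⟨Re(w χ₀)⟩_{J,u}| ≤ ‖w‖ ⟨Re χ₀⟩_{J,1}` — equivalently the modulus of the complex expectation
  `⟨χ₀⟩_{J,u}` is at most `⟨Re χ₀⟩_{J,1}`; this is the input of Fröhlich's 1979 comparison of a
  `U(N)` lattice gauge theory with the `U(1)` theory of its centre;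
* `abs_phasedGinibreExpect_re_mul_le_of_le`: combined with Ginibre's monotonicity
  (`ginibreExpect_reChar_mono`), `|⟨Re(w χ₀)⟩_{J,u}| ≤ ‖w‖ ⟨Re χ₀⟩_{J',1}` for `0 ≤ J ≤ J'`.

Proof (the source's, Appendix of Garban–Spencer 2022, as in `MMPInequality.lean`): write
`u = v²`, `ξ = λ²` in `U(1)`; with `θ = φψ⁻¹` (pure system) and `θ' = φψ` (phased system),
`Z_1 Z_u (⟨Re χ₀⟩_1 − ⟨Re(ξχ₀)⟩_u) = ∫∫ (Re χ₀(θ) − Re(ξχ₀(θ'))) w_1(θ) w_u(θ') dθ dθ'` (Fubini)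
`= ∫∫ 2 Im(λχ₀(φ)) Im(λχ₀(ψ)) exp(∑ₐ 2Jₐ Re(vₐχₐ(φ)) Re(vₐχₐ(ψ))) dφ dψ` (the duplication map
preserves `dθ dθ'`, `integral_comp_dupHom`; the identities `cos A + cos(B + ω) =
2 cos(φ + ω/2) cos(ψ + ω/2)`-type are `phased_exponent`, `phased_observable`), and the last
integrand is a limit of positive kernels (`expTrunc`), hence has a non-negative integral.
Everything is PROVED; no named fact is introduced.

## References

* A. Messager, S. Miracle-Solé, C. Pfister, Comm. Math. Phys. 58 (1978) 19–29, Prop. 1.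
  [MessagerMiracleSolePfister1978]
* C. Garban, T. Spencer, J. Math. Phys. 63 (2022) 093302, arXiv:2109.01617, Appendix Thm. 7.1
  (the duplication proof). [GarbanSpencer2022]
* P. Dario, C. Garban *et al.*, arXiv:2311.16546, Prop. 7.16 and Remark 21 (p. 37): restatement.
* J. Ginibre, Comm. Math. Phys. 16 (1970) 310–328 (duplication method). [Ginibre1970]
-/

noncomputable section

open MeasureTheory Filter Finset
open scoped Topology BigOperators ComplexConjugate

namespace Literature.Probability.LatticeModels

/-! ### Phase-shifted characters and the phased Ginibre model -/

section Phased

variable {Ω : Type*} [CommGroup Ω] [TopologicalSpace Ω] {ι : Type*} [Fintype ι]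

/-- The phase-shifted cosine `Re(u χ(θ))` (`cos(m·θ + ω)` for rotators, `u = e^{iω}`).
[cite: MessagerMiracleSolePfister1978, Prop. 1] -/
def rePhased (u : Circle) (χ : Ω →ₜ* Circle) (θ : Ω) : ℝ :=
  ((u : ℂ) * ((χ θ : Circle) : ℂ)).re

/-- The phase-shifted sine `Im(u χ(θ))`. [cite: MessagerMiracleSolePfister1978, Prop. 1] -/
def imPhased (u : Circle) (χ : Ω →ₜ* Circle) (θ : Ω) : ℝ :=
  ((u : ℂ) * ((χ θ : Circle) : ℂ)).im

/-- `Re(1 · χ) = Re χ`. [cite: GarbanSpencer2022, Appendix (set-up of Theorem 7.1)] -/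
@[simp] theorem rePhased_one (χ : Ω →ₜ* Circle) : rePhased 1 χ = reChar χ := by
  funext θ; simp [rePhased, reChar]

/-- `Re((−u) χ) = −Re(u χ)`. [cite: GarbanSpencer2022, Appendix (set-up of Theorem 7.1)] -/
theorem rePhased_neg (u : Circle) (χ : Ω →ₜ* Circle) (θ : Ω) :
    rePhased (-u) χ θ = -rePhased u χ θ := by
  simp [rePhased]

/-- `Re(u χ)` is continuous. [cite: GarbanSpencer2022, Appendix (set-up of Theorem 7.1)] -/
theorem continuous_rePhased (u : Circle) (χ : Ω →ₜ* Circle) : Continuous (rePhased u χ) :=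
  Complex.continuous_re.comp (continuous_const.mul (continuous_subtype_val.comp (map_continuous χ)))

/-- `Im(u χ)` is continuous. [cite: GarbanSpencer2022, Appendix (set-up of Theorem 7.1)] -/
theorem continuous_imPhased (u : Circle) (χ : Ω →ₜ* Circle) : Continuous (imPhased u χ) :=
  Complex.continuous_im.comp (continuous_const.mul (continuous_subtype_val.comp (map_continuous χ)))

/-- `|Re(u χ)| ≤ 1`. [cite: GarbanSpencer2022, Appendix (set-up of Theorem 7.1)] -/
theorem abs_rePhased_le_one (u : Circle) (χ : Ω →ₜ* Circle) (θ : Ω) : |rePhased u χ θ| ≤ 1 := by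
  refine (Complex.abs_re_le_norm _).trans ?_
  rw [norm_mul, Circle.norm_coe, Circle.norm_coe, mul_one]

/-- `|Im(u χ)| ≤ 1`. [cite: GarbanSpencer2022, Appendix (set-up of Theorem 7.1)] -/
theorem abs_imPhased_le_one (u : Circle) (χ : Ω →ₜ* Circle) (θ : Ω) : |imPhased u χ θ| ≤ 1 := by
  refine (Complex.abs_im_le_norm _).trans ?_
  rw [norm_mul, Circle.norm_coe, Circle.norm_coe, mul_one]

/-- The phased (negative) Hamiltonian `∑ₐ Jₐ Re(uₐ χₐ(θ))` — couplings `Jₐ` with phases `uₐ`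
(`∑ J_A cos(m_A·θ + ω_A)` for rotators; quenched bond phases / twists; for the `U(1)`-part of a
`U(N)` gauge field, the phases of the traces of the non-abelian plaquettes).
[cite: MessagerMiracleSolePfister1978, Prop. 1] -/
def phasedHamiltonian (χ : ι → Ω →ₜ* Circle) (J : ι → ℝ) (u : ι → Circle) (θ : Ω) : ℝ :=
  ∑ a, J a * rePhased (u a) (χ a) θ

/-- The phased Gibbs weight `exp(∑ₐ Jₐ Re(uₐ χₐ(θ)))`. [cite: MessagerMiracleSolePfister1978, Prop. 1] -/
def phasedGinibreWeight (χ : ι → Ω →ₜ* Circle) (J : ι → ℝ) (u : ι → Circle) (θ : Ω) : ℝ :=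
  Real.exp (phasedHamiltonian χ J u θ)

/-- The phased Gibbs expectation `⟨F⟩_{J,u} = ∫ F e^{∑ Jₐ Re(uₐχₐ)} dμ / ∫ e^{∑ Jₐ Re(uₐχₐ)} dμ`.
[cite: MessagerMiracleSolePfister1978, Prop. 1] -/
def phasedGinibreExpect [MeasurableSpace Ω] (μ : Measure Ω) (χ : ι → Ω →ₜ* Circle) (J : ι → ℝ)
    (u : ι → Circle) (F : Ω → ℝ) : ℝ :=
  (∫ θ, F θ * phasedGinibreWeight χ J u θ ∂μ) / ∫ θ, phasedGinibreWeight χ J u θ ∂μ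

/-- Without phases the phased Hamiltonian is Ginibre's. [cite: GarbanSpencer2022, Appendix (set-up of Theorem 7.1)] -/
@[simp] theorem phasedHamiltonian_one (χ : ι → Ω →ₜ* Circle) (J : ι → ℝ) :
    phasedHamiltonian χ J 1 = ginibreHamiltonian χ J := by
  funext θ; simp [phasedHamiltonian, ginibreHamiltonian, rePhased, reChar]

/-- Without phases the phased weight is Ginibre's. [cite: GarbanSpencer2022, Appendix (set-up of Theorem 7.1)] -/
@[simp] theorem phasedGinibreWeight_one (χ : ι → Ω →ₜ* Circle) (J : ι → ℝ) :
    phasedGinibreWeight χ J 1 = ginibreWeight χ J := by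
  funext θ; simp [phasedGinibreWeight, ginibreWeight]

/-- Without phases the phased expectation is Ginibre's. [cite: GarbanSpencer2022, Appendix (set-up of Theorem 7.1)] -/
@[simp] theorem phasedGinibreExpect_one [MeasurableSpace Ω] (μ : Measure Ω)
    (χ : ι → Ω →ₜ* Circle) (J : ι → ℝ) (F : Ω → ℝ) :
    phasedGinibreExpect μ χ J 1 F = ginibreExpect μ χ J F := by
  simp [phasedGinibreExpect, ginibreExpect]

/-- The phased Hamiltonian is continuous. [cite: GarbanSpencer2022, Appendix (set-up of Theorem 7.1)] -/
theorem continuous_phasedHamiltonian (χ : ι → Ω →ₜ* Circle) (J : ι → ℝ) (u : ι → Circle) :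
    Continuous (phasedHamiltonian χ J u) := by
  unfold phasedHamiltonian
  exact continuous_finsetSum _ fun a _ => continuous_const.mul (continuous_rePhased _ _)

/-- The phased weight is continuous. [cite: GarbanSpencer2022, Appendix (set-up of Theorem 7.1)] -/
theorem continuous_phasedGinibreWeight (χ : ι → Ω →ₜ* Circle) (J : ι → ℝ) (u : ι → Circle) :
    Continuous (phasedGinibreWeight χ J u) :=
  Real.continuous_exp.comp (continuous_phasedHamiltonian χ J u)

/-- The phased expectation is homogeneous in the observable. [cite: GarbanSpencer2022, Appendix (set-up of Theorem 7.1)] -/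
theorem phasedGinibreExpect_const_mul [MeasurableSpace Ω] (μ : Measure Ω)
    (χ : ι → Ω →ₜ* Circle) (J : ι → ℝ) (u : ι → Circle) (c : ℝ) (F : Ω → ℝ) :
    phasedGinibreExpect μ χ J u (fun θ => c * F θ) = c * phasedGinibreExpect μ χ J u F := by
  simp only [phasedGinibreExpect, mul_assoc, integral_const_mul, mul_div_assoc]

/-- The phased expectation of `−F` is `−⟨F⟩`. [cite: GarbanSpencer2022, Appendix (set-up of Theorem 7.1)] -/
theorem phasedGinibreExpect_neg [MeasurableSpace Ω] (μ : Measure Ω)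
    (χ : ι → Ω →ₜ* Circle) (J : ι → ℝ) (u : ι → Circle) (F : Ω → ℝ) :
    phasedGinibreExpect μ χ J u (fun θ => -F θ) = -phasedGinibreExpect μ χ J u F := by
  have h := phasedGinibreExpect_const_mul μ χ J u (-1) F
  simp only [neg_mul, one_mul] at h
  exact h

/-! ### The duplicated integrand -/

/-- `2 Re a Re b = Re(ab) + Re(a b̄)`. [folklore] -/
private theorem two_mul_re_mul_re (a b : ℂ) : 2 * (a.re * b.re) = (a * b).re + (a * conj b).re := by
  simp only [Complex.mul_re, Complex.conj_re, Complex.conj_im]; ring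

/-- `2 Im a Im b = Re(a b̄) − Re(ab)`. [folklore] -/
private theorem two_mul_im_mul_im (a b : ℂ) : 2 * (a.im * b.im) = (a * conj b).re - (a * b).re := by
  simp only [Complex.mul_re, Complex.conj_re, Complex.conj_im]; ring

/-- `v · v̄ = 1` in `U(1)`. [folklore] -/
private theorem coe_mul_conj_coe (v : Circle) : (v : ℂ) * conj (v : ℂ) = 1 := by
  rw [Complex.mul_conj, Circle.normSq_coe, Complex.ofReal_one]

/-- **The exponent identity** (`cos θₐ + cos(θ'ₐ + ωₐ) = 2 cos(φₐ + ωₐ/2) cos(ψₐ + ωₐ/2)` in group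
form): with `θ = φψ⁻¹`, `θ' = φψ`, `u = v²`,
`∑ₐ Jₐ Re χₐ(φψ⁻¹) + ∑ₐ Jₐ Re(vₐ² χₐ(φψ)) = 2 ∑ₐ Jₐ Re(vₐχₐ(φ)) Re(vₐχₐ(ψ))`.
[cite: GarbanSpencer2022, Appendix, proof of Theorem 7.1] -/
theorem phased_exponent (χ : ι → Ω →ₜ* Circle) (J : ι → ℝ) (v : ι → Circle) (φ ψ : Ω) :
    ginibreHamiltonian χ J (φ * ψ⁻¹) + phasedHamiltonian χ J (fun a => v a * v a) (φ * ψ) =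
      2 * ∑ a, J a * (rePhased (v a) (χ a) φ * rePhased (v a) (χ a) ψ) := by
  simp only [ginibreHamiltonian, phasedHamiltonian, Finset.mul_sum, ← Finset.sum_add_distrib]
  refine Finset.sum_congr rfl fun a _ => ?_
  simp only [reChar, rePhased, map_mul, map_inv, Circle.coe_mul, Circle.coe_inv_eq_conj]
  set P : ℂ := ((χ a φ : Circle) : ℂ)
  set Q : ℂ := ((χ a ψ : Circle) : ℂ)
  have hz := coe_mul_conj_coe (v a)
  have e1 : P * conj Q = ((v a : ℂ) * P) * conj ((v a : ℂ) * Q) := by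
    rw [map_mul]
    linear_combination (-(P * conj Q)) * hz
  have e2 : (v a : ℂ) * (v a) * (P * Q) = ((v a : ℂ) * P) * ((v a : ℂ) * Q) := by ring
  rw [e1, e2]
  have key := two_mul_re_mul_re ((v a : ℂ) * P) ((v a : ℂ) * Q)
  linear_combination (-(J a)) * key

/-- **The observable identity** (`cos A − cos(B + α) = 2 sin(φ + α/2) sin(ψ + α/2)`-type): with
`θ = φψ⁻¹`, `θ' = φψ`, `ξ = λ²`, `Re χ₀(φψ⁻¹) − Re(λ² χ₀(φψ)) = 2 Im(λχ₀(φ)) Im(λχ₀(ψ))`.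
[cite: GarbanSpencer2022, Appendix, proof of Theorem 7.1] -/
theorem phased_observable (χ₀ : Ω →ₜ* Circle) (lam : Circle) (φ ψ : Ω) :
    reChar χ₀ (φ * ψ⁻¹) - rePhased (lam * lam) χ₀ (φ * ψ) =
      2 * (imPhased lam χ₀ φ * imPhased lam χ₀ ψ) := by
  simp only [reChar, rePhased, imPhased, map_mul, map_inv, Circle.coe_mul, Circle.coe_inv_eq_conj]
  set P : ℂ := ((χ₀ φ : Circle) : ℂ)
  set Q : ℂ := ((χ₀ ψ : Circle) : ℂ)
  have hz := coe_mul_conj_coe lam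
  have e1 : P * conj Q = ((lam : ℂ) * P) * conj ((lam : ℂ) * Q) := by
    rw [map_mul]
    linear_combination (-(P * conj Q)) * hz
  have e2 : (lam : ℂ) * lam * (P * Q) = ((lam : ℂ) * P) * ((lam : ℂ) * Q) := by ring
  rw [e1, e2, two_mul_im_mul_im]

/-- The duplicated kernel `2 Im(λχ₀(φ)) Im(λχ₀(ψ)) · exp(2 ∑ₐ Jₐ Re(vₐχₐ(φ)) Re(vₐχₐ(ψ)))`, the
pull-back under the duplication map of `(Re χ₀(θ) − Re(ξχ₀(θ'))) w_1(θ) w_u(θ')`.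
[cite: GarbanSpencer2022, Appendix, proof of Theorem 7.1] -/
def phasedKernel (χ : ι → Ω →ₜ* Circle) (J : ι → ℝ) (v : ι → Circle) (χ₀ : Ω →ₜ* Circle)
    (lam : Circle) (p : Ω × Ω) : ℝ :=
  2 * (imPhased lam χ₀ p.1 * imPhased lam χ₀ p.2) *
    Real.exp (2 * ∑ a, J a * (rePhased (v a) (χ a) p.1 * rePhased (v a) (χ a) p.2))

/-- **Pull-back of the duplicated difference**: for `θ = φψ⁻¹`, `θ' = φψ`, `u = v²`, `ξ = λ²`,
`(Re χ₀(θ) − Re(ξχ₀(θ'))) · w_u(θ') · w_1(θ) = phasedKernel (φ, ψ)`.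
[cite: GarbanSpencer2022, Appendix, proof of Theorem 7.1] -/
theorem phased_key (χ : ι → Ω →ₜ* Circle) (J : ι → ℝ) (v : ι → Circle) (χ₀ : Ω →ₜ* Circle)
    (lam : Circle) (φ ψ : Ω) :
    (reChar χ₀ (φ * ψ⁻¹) - rePhased (lam * lam) χ₀ (φ * ψ)) *
        (phasedGinibreWeight χ J (fun a => v a * v a) (φ * ψ) * ginibreWeight χ J (φ * ψ⁻¹)) =
      phasedKernel χ J v χ₀ lam (φ, ψ) := by
  rw [phased_observable, phasedKernel, phasedGinibreWeight, ginibreWeight, ← Real.exp_add,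
    add_comm, phased_exponent]

/-- Truncations of the phased kernel (the exponential replaced by its Taylor polynomial) are
positive kernels when `J ≥ 0`. [cite: GarbanSpencer2022, Appendix, proof of Theorem 7.1] -/
theorem isPosKernel_phasedTrunc (χ : ι → Ω →ₜ* Circle) {J : ι → ℝ} (hJ : ∀ a, 0 ≤ J a)
    (v : ι → Circle) (χ₀ : Ω →ₜ* Circle) (lam : Circle) (N : ℕ) :
    IsPosKernel fun p : Ω × Ω =>
      2 * (imPhased lam χ₀ p.1 * imPhased lam χ₀ p.2) *
        expTrunc N (2 * ∑ a, J a * (rePhased (v a) (χ a) p.1 * rePhased (v a) (χ a) p.2)) := by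
  have h1 : IsPosKernel fun p : Ω × Ω => 2 * (imPhased lam χ₀ p.1 * imPhased lam χ₀ p.2) :=
    (isPosKernel_mul_self (continuous_imPhased lam χ₀)).const_mul zero_le_two
  have h2 : IsPosKernel fun p : Ω × Ω =>
      2 * ∑ a, J a * (rePhased (v a) (χ a) p.1 * rePhased (v a) (χ a) p.2) := by
    have : (fun p : Ω × Ω => 2 * ∑ a, J a * (rePhased (v a) (χ a) p.1 * rePhased (v a) (χ a) p.2)) =
        fun p => 2 * (∑ a, fun q : Ω × Ω => J a * (rePhased (v a) (χ a) q.1 * rePhased (v a) (χ a) q.2)) p := by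
      funext p; simp only [Finset.sum_apply]
    rw [this]
    exact (IsPosKernel.sum fun a _ =>
      (isPosKernel_mul_self (continuous_rePhased (v a) (χ a))).const_mul (hJ a)).const_mul zero_le_two
  exact h1.mul (h2.comp_expTrunc N)

/-- The exponent of the phased kernel is bounded by `2 ∑ₐ Jₐ` (`J ≥ 0`). [cite: GarbanSpencer2022, Appendix, proof of Theorem 7.1] -/
theorem abs_phased_exponent_le (χ : ι → Ω →ₜ* Circle) {J : ι → ℝ} (hJ : ∀ a, 0 ≤ J a)
    (v : ι → Circle) (p : Ω × Ω) :
    |2 * ∑ a, J a * (rePhased (v a) (χ a) p.1 * rePhased (v a) (χ a) p.2)| ≤ 2 * ∑ a, J a := by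
  rw [abs_mul, abs_two]
  refine mul_le_mul_of_nonneg_left ((Finset.abs_sum_le_sum_abs _ _).trans
    (Finset.sum_le_sum fun a _ => ?_)) zero_le_two
  rw [abs_mul, abs_of_nonneg (hJ a), abs_mul]
  calc J a * (|rePhased (v a) (χ a) p.1| * |rePhased (v a) (χ a) p.2|) ≤ J a * (1 * 1) := by
        gcongr
        · exact hJ a
        · exact abs_rePhased_le_one _ _ _
        · exact abs_rePhased_le_one _ _ _
    _ = J a := by ring

variable [CompactSpace Ω] [SecondCountableTopology Ω] [MeasurableSpace Ω] [BorelSpace Ω]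

/-- **Positivity of the duplicated integral**: `∫∫ phasedKernel d(μ ⊗ μ) ≥ 0` for `J ≥ 0` and any
finite measure `μ`: dominated limit of the integrals of its truncations, each the integral of a
positive kernel. [cite: GarbanSpencer2022, Appendix, proof of Theorem 7.1] -/
theorem integral_phasedKernel_nonneg (μ : Measure Ω) [IsFiniteMeasure μ] (χ : ι → Ω →ₜ* Circle)
    {J : ι → ℝ} (hJ : ∀ a, 0 ≤ J a) (v : ι → Circle) (χ₀ : Ω →ₜ* Circle) (lam : Circle) :
    0 ≤ ∫ p, phasedKernel χ J v χ₀ lam p ∂(μ.prod μ) := by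
  set T : ℕ → Ω × Ω → ℝ := fun N p =>
    2 * (imPhased lam χ₀ p.1 * imPhased lam χ₀ p.2) *
      expTrunc N (2 * ∑ a, J a * (rePhased (v a) (χ a) p.1 * rePhased (v a) (χ a) p.2)) with hT
  have hpos : ∀ N, IsPosKernel (T N) := fun N => isPosKernel_phasedTrunc χ hJ v χ₀ lam N
  have hlim : Tendsto (fun N => ∫ p, T N p ∂(μ.prod μ)) atTop
      (𝓝 (∫ p, phasedKernel χ J v χ₀ lam p ∂(μ.prod μ))) := by
    refine tendsto_integral_of_dominated_convergence
      (fun _ => 2 * Real.exp (2 * ∑ a, J a)) ?_ (integrable_const _) ?_ ?_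
    · exact fun N => (hpos N).continuous.aestronglyMeasurable
    · refine fun N => ae_of_all _ fun p => ?_
      rw [Real.norm_eq_abs, hT]
      dsimp only
      rw [abs_mul, abs_mul, abs_two]
      refine mul_le_mul (mul_le_of_le_one_right zero_le_two ?_)
        (abs_expTrunc_le (abs_phased_exponent_le χ hJ v p) N) (abs_nonneg _) zero_le_two
      rw [abs_mul]
      exact mul_le_one₀ (abs_imPhased_le_one lam χ₀ _) (abs_nonneg _) (abs_imPhased_le_one lam χ₀ _)
    · refine ae_of_all _ fun p => ?_
      exact (tendsto_expTrunc _).const_mul _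
  exact ge_of_tendsto' hlim fun N => (hpos N).integral_nonneg _

omit [CommGroup Ω] in
/-- Fubini form of the duplicated difference:
`∫∫ (f(θ) − g(θ')) w'(θ') w(θ) = (∫ w')(∫ f w) − (∫ g w')(∫ w)`. [cite: GarbanSpencer2022, Appendix, proof of Theorem 7.1] -/
theorem integral_sub_mul_mul_general (μ : Measure Ω) [IsFiniteMeasure μ] {f g w w' : Ω → ℝ}
    (hf : Continuous f) (hg : Continuous g) (hw : Continuous w) (hw' : Continuous w') :
    ∫ p, (f p.2 - g p.1) * (w' p.1 * w p.2) ∂(μ.prod μ) =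
      (∫ θ, w' θ ∂μ) * (∫ θ, f θ * w θ ∂μ) - (∫ θ, g θ * w' θ ∂μ) * (∫ θ, w θ ∂μ) := by
  have e : ∀ p : Ω × Ω, (f p.2 - g p.1) * (w' p.1 * w p.2) =
      w' p.1 * (f p.2 * w p.2) - (g p.1 * w' p.1) * w p.2 := fun p => by ring
  simp_rw [e]
  have i1 : Integrable (fun p : Ω × Ω => w' p.1 * (f p.2 * w p.2)) (μ.prod μ) :=
    integrable_of_continuous_compactSpace _ (by fun_prop)
  have i2 : Integrable (fun p : Ω × Ω => (g p.1 * w' p.1) * w p.2) (μ.prod μ) :=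
    integrable_of_continuous_compactSpace _ (by fun_prop)
  rw [integral_sub i1 i2, integral_prod_mul (μ := μ) (ν := μ) w' (fun θ => f θ * w θ),
    integral_prod_mul (μ := μ) (ν := μ) (fun θ => g θ * w' θ) w]

/-! ### The inequality -/

omit [SecondCountableTopology Ω] in
/-- The phased partition function is positive. [cite: GarbanSpencer2022, Appendix (set-up of Theorem 7.1)] -/
theorem integral_phasedGinibreWeight_pos (μ : Measure Ω) [μ.IsHaarMeasure] [IsProbabilityMeasure μ]
    (χ : ι → Ω →ₜ* Circle) (J : ι → ℝ) (u : ι → Circle) :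
    0 < ∫ θ, phasedGinibreWeight χ J u θ ∂μ :=
  integral_exp_pos (integrable_of_continuous_compactSpace μ (continuous_phasedGinibreWeight χ J u))

variable [IsTopologicalGroup Ω]

/-- **Messager–Miracle-Solé–Pfister inequality, general framework.** Let `Ω` be a compact
second-countable abelian group in which every element is a square, `μ` a Haar probability measure,
`χₐ, χ₀` continuous unitary characters, `Jₐ ≥ 0` couplings, `uₐ ∈ U(1)` phases on the couplings and
`ξ ∈ U(1)` a phase on the observable. Then
`⟨Re(ξ χ₀)⟩_{J,u} ≤ ⟨Re χ₀⟩_{J,1}`: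
phases — on the interaction terms or on the observable — can only lower the correlations of a
ferromagnetic generalised plane rotator (MMP 1978 Prop. 1, «proved in a much more general
framework» than the two-point `XY` case restated in arXiv:2311.16546 Prop. 7.16; proof by the
duplication of Garban–Spencer 2022 Appendix Thm. 7.1). The bond-system case `ξ = 1`, pair
characters, uniform coupling, is the tree's `BondSystem.expect_reChar_le_expect_one`.
[cite: MessagerMiracleSolePfister1978, Prop. 1] [cite: GarbanSpencer2022, Appendix Theorem 7.1] -/
theorem phasedGinibreExpect_rePhased_le (μ : Measure Ω) [μ.IsHaarMeasure] [IsProbabilityMeasure μ]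
    (h2 : Function.Surjective fun ψ : Ω => ψ * ψ) (χ : ι → Ω →ₜ* Circle) {J : ι → ℝ}
    (hJ : ∀ a, 0 ≤ J a) (u : ι → Circle) (ξ : Circle) (χ₀ : Ω →ₜ* Circle) :
    phasedGinibreExpect μ χ J u (rePhased ξ χ₀) ≤ ginibreExpect μ χ J (reChar χ₀) := by
  -- square roots of the phases
  set v : ι → Circle := fun a => Circle.exp (Complex.arg (u a : ℂ) / 2) with hv
  have huv : (fun a => v a * v a) = u := by
    funext a; rw [hv, ← Circle.exp_add, add_halves, Circle.exp_arg]
  set lam : Circle := Circle.exp (Complex.arg (ξ : ℂ) / 2) with hlam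
  have hξ : lam * lam = ξ := by rw [hlam, ← Circle.exp_add, add_halves, Circle.exp_arg]
  rw [← huv, ← hξ]
  set u' : ι → Circle := fun a => v a * v a
  have hf := continuous_reChar χ₀
  have hg := continuous_rePhased (lam * lam) χ₀
  have hw1 := continuous_ginibreWeight χ J
  have hwu := continuous_phasedGinibreWeight χ J u'
  have hZ1 : 0 < ∫ θ, ginibreWeight χ J θ ∂μ :=
    integral_exp_pos (integrable_of_continuous_compactSpace μ hw1)
  have hZu := integral_phasedGinibreWeight_pos μ χ J u'
  unfold phasedGinibreExpect ginibreExpect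
  rw [div_le_div_iff₀ hZu hZ1]
  -- the duplicated difference is the integral of the phased kernel
  have hdup := integral_sub_mul_mul_general μ hf hg hw1 hwu
  have hcont : Continuous fun p : Ω × Ω =>
      (reChar χ₀ p.2 - rePhased (lam * lam) χ₀ p.1) *
        (phasedGinibreWeight χ J u' p.1 * ginibreWeight χ J p.2) := by fun_prop
  have hcv := integral_comp_dupHom μ h2 hcont
  simp only [dupHom_apply] at hcv
  have hI : ∫ p : Ω × Ω, (reChar χ₀ (p.1 * p.2⁻¹) - rePhased (lam * lam) χ₀ (p.1 * p.2)) *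
        (phasedGinibreWeight χ J u' (p.1 * p.2) * ginibreWeight χ J (p.1 * p.2⁻¹)) ∂(μ.prod μ) =
      ∫ p, phasedKernel χ J v χ₀ lam p ∂(μ.prod μ) :=
    integral_congr_ae (ae_of_all _ fun p => phased_key χ J v χ₀ lam p.1 p.2)
  have hpos := integral_phasedKernel_nonneg μ χ hJ v χ₀ lam
  rw [← hI, hcv, hdup] at hpos
  linarith [hpos]

/-- **Two-sided form**: `|⟨Re(ξ χ₀)⟩_{J,u}| ≤ ⟨Re χ₀⟩_{J,1}` (apply the inequality to `ξ` and to
`−ξ`). In particular (`u = 1`, `ξ = 1`) Griffiths' first inequality `0 ≤ ⟨Re χ₀⟩_{J,1}`, cf. the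
tree's `ginibreExpect_reChar_nonneg_dual`. [cite: MessagerMiracleSolePfister1978, Prop. 1] -/
theorem abs_phasedGinibreExpect_rePhased_le (μ : Measure Ω) [μ.IsHaarMeasure]
    [IsProbabilityMeasure μ] (h2 : Function.Surjective fun ψ : Ω => ψ * ψ)
    (χ : ι → Ω →ₜ* Circle) {J : ι → ℝ} (hJ : ∀ a, 0 ≤ J a) (u : ι → Circle) (ξ : Circle)
    (χ₀ : Ω →ₜ* Circle) :
    |phasedGinibreExpect μ χ J u (rePhased ξ χ₀)| ≤ ginibreExpect μ χ J (reChar χ₀) := by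
  refine abs_le.2 ⟨?_, phasedGinibreExpect_rePhased_le μ h2 χ hJ u ξ χ₀⟩
  have h := phasedGinibreExpect_rePhased_le μ h2 χ hJ u (-ξ) χ₀
  have e : rePhased (-ξ) χ₀ = fun θ => -rePhased ξ χ₀ θ := funext fun θ => rePhased_neg ξ χ₀ θ
  rw [e, phasedGinibreExpect_neg] at h
  linarith

/-- **Complex form** (the input of Fröhlich's `U(N)` ⊇ `U(1)` comparison): for every `w ∈ ℂ`,
`|⟨Re(w χ₀)⟩_{J,u}| ≤ ‖w‖ · ⟨Re χ₀⟩_{J,1}`; taking `w = conj ⟨χ₀⟩_{J,u} / |⟨χ₀⟩_{J,u}|` this says that the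
complex expectation `⟨χ₀⟩_{J,u}` has modulus at most `⟨Re χ₀⟩_{J,1}`.
[cite: MessagerMiracleSolePfister1978, Prop. 1] -/
theorem abs_phasedGinibreExpect_re_mul_le (μ : Measure Ω) [μ.IsHaarMeasure]
    [IsProbabilityMeasure μ] (h2 : Function.Surjective fun ψ : Ω => ψ * ψ)
    (χ : ι → Ω →ₜ* Circle) {J : ι → ℝ} (hJ : ∀ a, 0 ≤ J a) (u : ι → Circle) (w : ℂ)
    (χ₀ : Ω →ₜ* Circle) :
    |phasedGinibreExpect μ χ J u (fun θ => (w * ((χ₀ θ : Circle) : ℂ)).re)| ≤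
      ‖w‖ * ginibreExpect μ χ J (reChar χ₀) := by
  set ξ : Circle := Circle.exp (Complex.arg w) with hξ
  have hw : w = (‖w‖ : ℂ) * (ξ : ℂ) := by
    rw [hξ, Circle.coe_exp]; exact_mod_cast (Complex.norm_mul_exp_arg_mul_I w).symm
  have e : (fun θ => (w * ((χ₀ θ : Circle) : ℂ)).re) = fun θ => ‖w‖ * rePhased ξ χ₀ θ := by
    funext θ
    rw [rePhased, ← Complex.re_ofReal_mul, ← mul_assoc, ← hw]
  rw [e, phasedGinibreExpect_const_mul, abs_mul, abs_norm]
  exact mul_le_mul_of_nonneg_left (abs_phasedGinibreExpect_rePhased_le μ h2 χ hJ u ξ χ₀)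
    (norm_nonneg w)

/-- **Phases and weaker couplings** (MMP with Ginibre's monotonicity
`ginibreExpect_reChar_mono`): for `0 ≤ J ≤ J'`, all phases `u` and `w ∈ ℂ`,
`|⟨Re(w χ₀)⟩_{J,u}| ≤ ‖w‖ · ⟨Re χ₀⟩_{J',1}`. For the `U(1)`-part of a `U(N)` gauge field this is
Fröhlich's pointwise bound (`Jₚ = β|tr V_p| ≤ Nβ = J'`).
[cite: MessagerMiracleSolePfister1978, Prop. 1] [cite: Ginibre1970, main theorem with the plane-rotator example cos(m·φ)] -/
theorem abs_phasedGinibreExpect_re_mul_le_of_le (μ : Measure Ω) [μ.IsHaarMeasure]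
    [IsProbabilityMeasure μ] (h2 : Function.Surjective fun ψ : Ω => ψ * ψ)
    (χ : ι → Ω →ₜ* Circle) {J J' : ι → ℝ} (hJ : ∀ a, 0 ≤ J a) (hJJ' : ∀ a, J a ≤ J' a)
    (u : ι → Circle) (w : ℂ) (χ₀ : Ω →ₜ* Circle) :
    |phasedGinibreExpect μ χ J u (fun θ => (w * ((χ₀ θ : Circle) : ℂ)).re)| ≤
      ‖w‖ * ginibreExpect μ χ J' (reChar χ₀) :=
  (abs_phasedGinibreExpect_re_mul_le μ h2 χ hJ u w χ₀).trans
    (mul_le_mul_of_nonneg_left (ginibreExpect_reChar_mono μ h2 χ χ₀ hJ hJJ') (norm_nonneg w))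

end Phased

end Literature.Probability.LatticeModels

end
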